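import Summits.ResolutionOfSingularities.ResolutionOfSingularities.Theorems.HilbertSamuelEliminationCampaignW42DirectrixLinearSection
import Summits.ResolutionOfSingularities.ResolutionOfSingularities.Theorems.HilbertSamuelEliminationCampaignW42RidgeDimMonotoneOfThm3104
import Literature.RingTheory.HilbertSamuel.HypersurfaceSection
import Literature.RingTheory.HilbertSamuel.TangentConeChangeOfGenerators
import Literature.RingTheory.HilbertSamuel.DirectrixQuasiEtale
import Literature.RingTheory.HilbertSamuel.RegularCriterion
import Literature.RingTheory.HilbertSamuel.FlatBaseChange
import Literature.RingTheory.HilbertSamuel.PhiLowerBound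
import HarnessLib

/-!
# [OURS · L1 W4.2] The EQUALITY CASE of the hypersurface-section inequality `H⁽⁰⁾(A) ≤ H⁽¹⁾(A/tA)`: then `t ∉ 𝔪²`,
# `(𝔪ⁿ⁺¹ : t) = 𝔪ⁿ`, `gr(A/tA) = gr(A)/in(t)` — and the ridge / directrix dimensions drop by AT MOST ONE:
# `dim F(A) ≤ dim F(A/tA) + 1`, `e(A)_K ≤ e(A/tA)_K + 1` (Dietel (4.6.5) (ii) + (6.4.6); campaign s42, cell res-hironaka;
# informal crux `RidgeConfinement`, stmt-ResolutionOfSingularities-17845; `--supports`; brick B1 of the unconditional `RidgeDimMonotone`)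

HONEST FRAMING. OURS (slot W4.2, prover res-L1-s42-pv-1, gen 5). The tree proves (`HypersurfaceSection.lean`, CJS (3.14) first
inequality) that for a surjection of local rings `A → B` with kernel `tA`, `t ∈ 𝔪_A`, one has `H⁽⁰⁾(A) ≤ H⁽¹⁾(B)`. This file treats
the EQUALITY `H⁽¹⁾(B) = H⁽⁰⁾(A)` (Dietel's Prop. (4.6.5) (ii) = [H4, Prop. 6] = [Gi, I 3.9], the equality case of Bennett's
hypersurface-section lemma), which is what a NEAR point of a permissible blow-up produces at each of the `s + 1` sections cutting
`𝒪_{X',x'}` down to the fibre `𝒪_{π⁻¹(x),x'}` (Dietel (8.2.7.1)) and at each algebraic generator of a residue field extension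
(Dietel (8.2.3)):

* `mem_pow_of_mul_mem_pow_succ_of_hilbertSamuelFun_one_eq` — **`(𝔪ⁿ⁺¹ : t) = 𝔪ⁿ` for all `n`** (the length count behind the
  tree's inequality is an equality iff the kernel of `a ↦ ta : A/𝔪ⁿ → A/𝔪ⁿ⁺¹` vanishes); hence `t ∉ 𝔪²` and
  `emb.dim A = emb.dim B + 1` (`spanFinrank_eq_succ_of_hilbertSamuelFun_one_eq`);
* `tangentConeIdeal_eq_map_of_hilbertSamuelFun_one_eq` — **`gr(B) = gr(A)/in(t)`** in the tree's coordinates: for generators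
  `ȳ` of `𝔪_B` with lifts `y`, the family `z = (t, y)` generates `𝔪_A` and the tangent cone ideal `J_ȳ ⊆ k_B[Y_1..Y_e]` is the
  image of `J_z ⊆ k_A[X_0, X_1..X_e]` under `X_0 ↦ 0, X_{i+1} ↦ Y_i` (coefficients through `k_A ≅ k_B`);
* the consequences for the directrix / ridge dimensions (`e(A)_K ≤ e(B)_K + 1`, `dim F(A) ≤ dim F(B) + 1`, and the iterated form
  for `r` sections) are drawn in the sequel `…CampaignW42HypersurfaceSectionRidge.lean`.

NOTHING here is a statement of H. Hironaka's manuscript [Hironaka2017]. AI review is weaker than expert review.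
References (orientation only): B. Dietel, Dissertation Regensburg (2015), Prop. (4.6.5) p. 58, Lemma (6.4.6) p. 81, (8.2.3),
(8.2.7.1); H. Hironaka, J. Math. Kyoto Univ. 10 (1970), Prop. 6; J. Giraud, *Étude locale des singularités* (Orsay 1972) I 3.9;
V. Cossart, U. Jannsen, S. Saito, LNM 2270 (2020), proof of Thm. 3.10, (3.14).
-/

noncomputable section

-- single-conjunct summit: the doubled namespace component `ResolutionOfSingularities` is mandated
set_option linter.dupNamespace false

open IsLocalRing MvPolynomial Finset
open Literature.RingTheory.HilbertSamuel Literature.RingTheory.MvPolynomial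
open Literature.AlgebraicGeometry.Resolution

namespace Summit.ResolutionOfSingularities.ResolutionOfSingularities.Theorems

namespace CampaignW42

universe u v w

/-! ## The colon ideals `(𝔪ⁿ⁺¹ : t) = 𝔪ⁿ` in the equality case -/

section Colon

variable {A : Type u} {B : Type v} [CommRing A] [CommRing B] [IsLocalRing A] [IsLocalRing B] [IsNoetherianRing A]
  [Algebra A B] (hf : Function.Surjective (algebraMap A B)) {t : A}
  (hK : RingHom.ker (algebraMap A B) = Ideal.span {t})

omit [IsNoetherianRing A] in
include hK in
/-- The generator of the kernel lies in `𝔪_A`. [folklore] -/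
theorem mem_maximalIdeal_of_ker_eq_span : t ∈ maximalIdeal A :=
  IsLocalRing.le_maximalIdeal (RingHom.ker_ne_top (algebraMap A B)) (hK ▸ Ideal.mem_span_singleton_self t)

include hf hK in
/-- **Equality in the hypersurface-section inequality forces `(𝔪ⁿ⁺¹ : t) = 𝔪ⁿ`**: if `A → B` is a surjection of local
rings with kernel `tA` and `H⁽¹⁾(B) = H⁽⁰⁾(A)`, then `ta ∈ 𝔪ⁿ⁺¹ ⟹ a ∈ 𝔪ⁿ`. Indeed
`ℓ(A/𝔪ⁿ⁺¹) = ℓ(A/𝔪ⁿ) − ℓ((𝔪ⁿ⁺¹ : t)/𝔪ⁿ) + H⁽¹⁾(B)(n)` (the image of `a ↦ ta : A/𝔪ⁿ → A/𝔪ⁿ⁺¹` is the kernel of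
`A/𝔪ⁿ⁺¹ → A/(𝔪ⁿ⁺¹ + tA) = B/𝔪_Bⁿ⁺¹`), and `H⁽¹⁾(B)(n) = H⁽⁰⁾(A)(n) = ℓ(A/𝔪ⁿ⁺¹) − ℓ(A/𝔪ⁿ)`.
[cite: Dietel2015, Prop. (4.6.5) (ii) p. 58] [cite: Hironaka1970NumericalCharacters, Prop. 6] -/
theorem mem_pow_of_mul_mem_pow_succ_of_hilbertSamuelFun_one_eq (hH : hilbertSamuelFun B 1 = hilbertFun A) (n : ℕ) {a : A}
    (ha : t * a ∈ maximalIdeal A ^ (n + 1)) : a ∈ maximalIdeal A ^ n := by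
  have ht : t ∈ maximalIdeal A := mem_maximalIdeal_of_ker_eq_span hK
  -- `φ : A/𝔪ⁿ → A/𝔪ⁿ⁺¹`, `a ↦ ta`
  let φ : (A ⧸ maximalIdeal A ^ n) →ₗ[A] (A ⧸ maximalIdeal A ^ (n + 1)) :=
    (maximalIdeal A ^ n).liftQ ((maximalIdeal A ^ (n + 1)).mkQ ∘ₗ LinearMap.mulLeft A t) (by
      intro b hb
      rw [LinearMap.mem_ker, LinearMap.comp_apply, LinearMap.mulLeft_apply, Submodule.mkQ_apply,
        Submodule.Quotient.mk_eq_zero, pow_succ']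
      exact Ideal.mul_mem_mul ht hb)
  have hφ : ∀ b : A, φ (Submodule.Quotient.mk b) = Submodule.Quotient.mk (t * b) := fun b => rfl
  -- `ψ : A/𝔪ⁿ⁺¹ → A/(𝔪ⁿ⁺¹ + tA)`
  let ψ : (A ⧸ maximalIdeal A ^ (n + 1)) →ₗ[A] (A ⧸ (maximalIdeal A ^ (n + 1) ⊔ Ideal.span {t})) :=
    Submodule.factor le_sup_left
  -- `ker ψ = range φ`
  have hkr : LinearMap.ker ψ = LinearMap.range φ := by
    apply le_antisymm
    · intro q hq
      obtain ⟨b, rfl⟩ := Submodule.mkQ_surjective _ q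
      rw [LinearMap.mem_ker] at hq
      change Submodule.factor _ (Submodule.mkQ _ b) = 0 at hq
      rw [Submodule.factor_mk, Submodule.mkQ_apply, Submodule.Quotient.mk_eq_zero, Submodule.mem_sup] at hq
      obtain ⟨p, hp, s, hs, hps⟩ := hq
      obtain ⟨c, rfl⟩ := Ideal.mem_span_singleton'.mp hs
      refine ⟨Submodule.Quotient.mk c, ?_⟩
      rw [hφ, Submodule.mkQ_apply, Submodule.Quotient.eq, ← hps]
      have : t * c - (p + c * t) = -p := by ring
      rw [this]
      exact (maximalIdeal A ^ (n + 1)).neg_mem hp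
    · rintro q ⟨q', rfl⟩
      obtain ⟨c, rfl⟩ := Submodule.mkQ_surjective _ q'
      rw [LinearMap.mem_ker, Submodule.mkQ_apply, hφ]
      change Submodule.factor _ (Submodule.mkQ _ (t * c)) = 0
      rw [Submodule.factor_mk, Submodule.mkQ_apply, Submodule.Quotient.mk_eq_zero]
      exact Submodule.mem_sup_right (Ideal.mem_span_singleton'.mpr ⟨c, mul_comm c t⟩)
  -- the two length identities
  have h1 : Module.length A (A ⧸ maximalIdeal A ^ (n + 1)) =
      Module.length A (LinearMap.range φ) + Module.length A (A ⧸ (maximalIdeal A ^ (n + 1) ⊔ Ideal.span {t})) := by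
    rw [← hkr]
    exact Module.length_eq_add_of_exact (LinearMap.ker ψ).subtype ψ (Submodule.subtype_injective _)
      (Submodule.factor_surjective _) (LinearMap.exact_subtype_ker_map ψ)
  have h2 : Module.length A (A ⧸ maximalIdeal A ^ n) =
      Module.length A (LinearMap.ker φ) + Module.length A (LinearMap.range φ) :=
    Module.length_eq_add_of_exact (LinearMap.ker φ).subtype φ.rangeRestrict (Submodule.subtype_injective _)
      (LinearMap.surjective_rangeRestrict φ)
      (LinearMap.exact_iff.mpr (by rw [LinearMap.ker_rangeRestrict, Submodule.range_subtype]))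
  have hB : Module.length A (A ⧸ (maximalIdeal A ^ (n + 1) ⊔ Ideal.span {t})) = (hilbertSamuelFun B 1 n : ℕ∞) := by
    rw [← hK]; exact length_quotient_pow_sup_ker_eq hf n
  rw [hB, hH, ← sum_range_hilbertFun_eq_length A (n + 1)] at h1
  rw [← sum_range_hilbertFun_eq_length A n] at h2
  -- the range has finite length `r`
  have hRfin : Module.length A (LinearMap.range φ) ≠ ⊤ := by
    intro htop
    rw [htop, top_add] at h1
    exact ENat.coe_ne_top _ h1
  obtain ⟨r, hr⟩ := ENat.ne_top_iff_exists.mp hRfin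
  have hKfin : Module.length A (LinearMap.ker φ) ≠ ⊤ := by
    intro htop
    rw [htop, top_add] at h2
    exact ENat.coe_ne_top _ h2
  obtain ⟨k, hk⟩ := ENat.ne_top_iff_exists.mp hKfin
  rw [← hr, ← Nat.cast_add, Nat.cast_inj, sum_range_succ] at h1
  rw [← hr, ← hk, ← Nat.cast_add, Nat.cast_inj] at h2
  have hk0 : k = 0 := by omega
  -- so `ker φ = 0`, and `ā ∈ ker φ`
  have hsub : Subsingleton (LinearMap.ker φ) := by
    rw [← Module.length_eq_zero_iff (R := A), ← hk, hk0, Nat.cast_zero]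
  have hmem : Submodule.Quotient.mk a ∈ LinearMap.ker φ := by
    rw [LinearMap.mem_ker, hφ, Submodule.Quotient.mk_eq_zero]
    exact ha
  have h0 : (⟨Submodule.Quotient.mk a, hmem⟩ : LinearMap.ker φ) = 0 := Subsingleton.elim _ _
  have h0' : (Submodule.Quotient.mk a : A ⧸ maximalIdeal A ^ n) = 0 := congrArg Subtype.val h0
  exact (Submodule.Quotient.mk_eq_zero _).mp h0'

include hf hK in
/-- In the equality case `t ∉ 𝔪²` (take `n = 1`, `a = 1`). [cite: Dietel2015, Prop. (4.6.5) (ii) p. 58] -/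
theorem notMem_sq_of_hilbertSamuelFun_one_eq (hH : hilbertSamuelFun B 1 = hilbertFun A) : t ∉ maximalIdeal A ^ 2 := by
  intro h2
  have h := mem_pow_of_mul_mem_pow_succ_of_hilbertSamuelFun_one_eq hf hK hH 1 (a := 1) (by rwa [mul_one])
  rw [pow_one] at h
  exact (IsLocalRing.maximalIdeal.isMaximal A).ne_top (Ideal.eq_top_of_isUnit_mem _ h isUnit_one)

include hf in
/-- In the equality case `emb.dim A = emb.dim B + 1` (read `H⁽¹⁾(B)(1) = 1 + emb.dim B` and `H⁽⁰⁾(A)(1) = emb.dim A`).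
[cite: Dietel2015, Prop. (4.6.5) (ii) p. 58] -/
theorem spanFinrank_eq_succ_of_hilbertSamuelFun_one_eq (hH : hilbertSamuelFun B 1 = hilbertFun A) :
    (maximalIdeal A).spanFinrank = (maximalIdeal B).spanFinrank + 1 := by
  haveI : IsNoetherianRing B := isNoetherianRing_of_surjective_algebraMap hf
  have h := congr_fun hH 1
  rw [Literature.RingTheory.HilbertSamuel.hilbertSamuelFun_apply_one B 1, hilbertFun_one_eq_spanFinrank] at h
  omega

end Colon

/-! ## Generators: `z = (t, y)` generates `𝔪_A` -/

section Generators

variable {A : Type u} {B : Type v} [CommRing A] [CommRing B] [IsLocalRing A] [IsLocalRing B]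
  [Algebra A B] (hf : Function.Surjective (algebraMap A B)) {t : A}
  (hK : RingHom.ker (algebraMap A B) = Ideal.span {t})
  {e : ℕ} {ybar : Fin e → B} (hybar : Ideal.span (Set.range ybar) = maximalIdeal B)
  {y : Fin e → A} (hy : ∀ i, algebraMap A B (y i) = ybar i)

/-- A homomorphism of local rings detects the maximal ideal on units: `f(a) ∈ 𝔪_B ⟹ a ∈ 𝔪_A`. [folklore] -/
theorem mem_maximalIdeal_of_map_mem {a : A} (ha : algebraMap A B a ∈ maximalIdeal B) : a ∈ maximalIdeal A := by
  by_contra hna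
  have hu : IsUnit a := by
    by_contra hnu
    exact hna ((IsLocalRing.mem_maximalIdeal a).mpr hnu)
  exact ((IsLocalRing.mem_maximalIdeal _).mp ha) (hu.map (algebraMap A B))

include hf hK hybar hy in
/-- **`z = (t, y)` generates `𝔪_A`** when `ȳ = f(y)` generates `𝔪_B` and `ker f = tA`. [folklore] -/
theorem span_range_cons_eq_maximalIdeal :
    Ideal.span (Set.range (Fin.cons t y : Fin (e + 1) → A)) = maximalIdeal A := by
  have ht : t ∈ maximalIdeal A := mem_maximalIdeal_of_ker_eq_span hK
  apply le_antisymm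
  · rw [Ideal.span_le]
    rintro _ ⟨i, rfl⟩
    refine Fin.cases ?_ (fun j => ?_) i
    · rw [Fin.cons_zero]; exact ht
    · rw [Fin.cons_succ]
      refine mem_maximalIdeal_of_map_mem (B := B) ?_
      rw [hy, ← hybar]
      exact Ideal.subset_span ⟨j, rfl⟩
  · intro a ha
    have hfa : algebraMap A B a ∈ (Ideal.span (Set.range (Fin.cons t y : Fin (e + 1) → A))).map (algebraMap A B) := by
      have h1 : algebraMap A B a ∈ maximalIdeal B := by
        rw [← map_maximalIdeal_eq_of_surjective hf]
        exact Ideal.mem_map_of_mem _ ha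
      rw [← hybar] at h1
      refine (Ideal.span_le.mpr ?_) h1
      rintro _ ⟨j, rfl⟩
      rw [SetLike.mem_coe, ← hy j]
      exact Ideal.mem_map_of_mem _ (Ideal.subset_span ⟨j.succ, by rw [Fin.cons_succ]⟩)
    rw [← Ideal.mem_comap, Ideal.comap_map_of_surjective _ hf, ← RingHom.ker_eq_comap_bot, hK] at hfa
    have hle : Ideal.span {t} ≤ Ideal.span (Set.range (Fin.cons t y : Fin (e + 1) → A)) :=
      (Ideal.span_singleton_le_iff_mem _).mpr (Ideal.subset_span ⟨0, by rw [Fin.cons_zero]⟩)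
    exact (sup_le le_rfl hle) hfa

omit [IsLocalRing A] [IsLocalRing B] in
include hK in
/-- `f ∘ (t, y) = (0, ȳ)`. [folklore] -/
theorem algebraMap_comp_cons (hy : ∀ i, algebraMap A B (y i) = ybar i) :
    (algebraMap A B) ∘ (Fin.cons t y : Fin (e + 1) → A) = (Fin.cons 0 ybar : Fin (e + 1) → B) := by
  funext i
  refine Fin.cases ?_ (fun j => ?_) i
  · rw [Function.comp_apply, Fin.cons_zero, Fin.cons_zero, ← RingHom.mem_ker, hK]
    exact Ideal.mem_span_singleton_self t
  · rw [Function.comp_apply, Fin.cons_succ, Fin.cons_succ, hy]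

end Generators

/-! ## The tangent cone ideal of `B = A/tA`: `gr(B) = gr(A)/in(t)` -/

section TangentCone

variable {A : Type u} {B : Type v} [CommRing A] [CommRing B] [IsLocalRing A] [IsLocalRing B] [IsNoetherianRing A]
  [Algebra A B] [IsLocalHom (algebraMap A B)] (hf : Function.Surjective (algebraMap A B)) {t : A}
  (hK : RingHom.ker (algebraMap A B) = Ideal.span {t}) (hH : hilbertSamuelFun B 1 = hilbertFun A)
  {e : ℕ} {ybar : Fin e → B} (hybar : Ideal.span (Set.range ybar) = maximalIdeal B)
  {y : Fin e → A} (hy : ∀ i, algebraMap A B (y i) = ybar i)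

omit [IsNoetherianRing A] in
/-- **The comparison map `θ : k_A[X_0, X_1, …, X_e] → k_B[Y_1, …, Y_e]`**: coefficients through the residue field map
`k_A → k_B`, `X_0 ↦ 0`, `X_{i+1} ↦ Y_i` (written out; no definition is introduced). Its value on the reduction of a form `F`
over `A` is the reduction of `F(0, Y)` over `B`. [folklore] -/
theorem killFirst_map_map_residue (F : MvPolynomial (Fin (e + 1)) A) :
    (aeval (Fin.cons 0 X : Fin (e + 1) → MvPolynomial (Fin e) (ResidueField B)) :
        MvPolynomial (Fin (e + 1)) (ResidueField B) →ₐ[ResidueField B] MvPolynomial (Fin e) (ResidueField B))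
      (MvPolynomial.map (ResidueField.map (algebraMap A B)) (MvPolynomial.map (residue A) F)) =
      MvPolynomial.map (residue B)
        ((aeval (Fin.cons 0 X : Fin (e + 1) → MvPolynomial (Fin e) B) :
          MvPolynomial (Fin (e + 1)) B →ₐ[B] MvPolynomial (Fin e) B) (MvPolynomial.map (algebraMap A B) F)) := by
  rw [MvPolynomial.map_map, ResidueField.map_comp_residue, ← MvPolynomial.map_map]
  have h := RingHom.congr_fun (map_comp_killFirst (residue B) e) (MvPolynomial.map (algebraMap A B) F)
  simp only [RingHom.coe_comp, Function.comp_apply, RingHom.coe_coe] at h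
  exact h.symm

include hf hK hH hy in
/-- **`gr(B) = gr(A)/in(t)`: the tangent cone ideal `J_ȳ ⊆ k_B[Y]` of `B` is the image of the tangent cone ideal
`J_{(t,y)} ⊆ k_A[X_0, X]` of `A` under `X_0 ↦ 0`, `X_{i+1} ↦ Y_i`**, in the equality case `H⁽¹⁾(B) = H⁽⁰⁾(A)` (where `(𝔪ⁿ : t) = 𝔪ⁿ⁻¹`
supplies, for a form `G(Y)` over `B` vanishing to order `d + 1` at `ȳ`, a form `G̃(X) − X_0·H(X_0, X)` over `A` vanishing to
order `d + 1` at `(t, y)`). [cite: Dietel2015, Prop. (4.6.5) (ii) p. 58] [cite: Hironaka1970NumericalCharacters, Prop. 6] -/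
theorem tangentConeIdeal_eq_map_of_hilbertSamuelFun_one_eq :
    tangentConeIdeal ybar hybar =
      (tangentConeIdeal (Fin.cons t y : Fin (e + 1) → A) (span_range_cons_eq_maximalIdeal hf hK hybar hy)).map
        (((aeval (Fin.cons 0 X : Fin (e + 1) → MvPolynomial (Fin e) (ResidueField B)) :
            MvPolynomial (Fin (e + 1)) (ResidueField B) →ₐ[ResidueField B] MvPolynomial (Fin e) (ResidueField B)) :
            MvPolynomial (Fin (e + 1)) (ResidueField B) →+* MvPolynomial (Fin e) (ResidueField B)).comp
          (MvPolynomial.map (ResidueField.map (algebraMap A B)))) := by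
  classical
  haveI : IsNoetherianRing B := isNoetherianRing_of_surjective_algebraMap hf
  have hz := span_range_cons_eq_maximalIdeal hf hK hybar hy
  set θ := ((aeval (Fin.cons 0 X : Fin (e + 1) → MvPolynomial (Fin e) (ResidueField B)) :
            MvPolynomial (Fin (e + 1)) (ResidueField B) →ₐ[ResidueField B] MvPolynomial (Fin e) (ResidueField B)) :
            MvPolynomial (Fin (e + 1)) (ResidueField B) →+* MvPolynomial (Fin e) (ResidueField B)).comp
          (MvPolynomial.map (ResidueField.map (algebraMap A B))) with hθ
  have hθF : ∀ F : MvPolynomial (Fin (e + 1)) A, θ (MvPolynomial.map (residue A) F) =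
      MvPolynomial.map (residue B) ((aeval (Fin.cons 0 X : Fin (e + 1) → MvPolynomial (Fin e) B) :
          MvPolynomial (Fin (e + 1)) B →ₐ[B] MvPolynomial (Fin e) B) (MvPolynomial.map (algebraMap A B) F)) := fun F => by
    rw [hθ, RingHom.comp_apply]
    exact killFirst_map_map_residue F
  -- evaluation at `ȳ` of `F(0, Y)` is `f(F(t, y))`
  have heval : ∀ F : MvPolynomial (Fin (e + 1)) A,
      eval ybar ((aeval (Fin.cons 0 X : Fin (e + 1) → MvPolynomial (Fin e) B) :
          MvPolynomial (Fin (e + 1)) B →ₐ[B] MvPolynomial (Fin e) B) (MvPolynomial.map (algebraMap A B) F)) =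
        algebraMap A B (eval (Fin.cons t y : Fin (e + 1) → A) F) := fun F => by
    have hfun : (fun i => aeval ybar ((Fin.cons 0 X : Fin (e + 1) → MvPolynomial (Fin e) B) i)) =
        (Fin.cons 0 ybar : Fin (e + 1) → B) := by
      funext i
      refine Fin.cases ?_ (fun j => ?_) i
      · simp only [Fin.cons_zero, map_zero]
      · simp only [Fin.cons_succ, aeval_X]
    have hcomp : (aeval ybar : MvPolynomial (Fin e) B →ₐ[B] B).comp
        (aeval (Fin.cons 0 X : Fin (e + 1) → MvPolynomial (Fin e) B)) = aeval (Fin.cons 0 ybar : Fin (e + 1) → B) := by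
      rw [MvPolynomial.comp_aeval, hfun]
    have happ := congrArg (fun φ : MvPolynomial (Fin (e + 1)) B →ₐ[B] B => φ (MvPolynomial.map (algebraMap A B) F)) hcomp
    simp only [AlgHom.comp_apply, aeval_eq_eval] at happ
    rw [map_eval, algebraMap_comp_cons hK hy, ← happ]
  apply le_antisymm
  · -- `J_ȳ ⊆ θ(J_z)`
    rw [tangentConeIdeal, Ideal.span_le]
    intro g hg
    obtain ⟨d, hgd⟩ := Set.mem_iUnion.mp hg
    obtain ⟨G, hGhom, hGy, rfl⟩ := (mem_symbolForms_iff_exists_form ybar hybar).mp hgd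
    -- lift `G` to a form over `A`
    obtain ⟨G₁, rfl⟩ := MvPolynomial.map_surjective (algebraMap A B) hf G
    set Gt : MvPolynomial (Fin e) A := homogeneousComponent d G₁ with hGt
    have hGthom : Gt.IsHomogeneous d := homogeneousComponent_isHomogeneous d G₁
    have hGtmap : MvPolynomial.map (algebraMap A B) Gt = MvPolynomial.map (algebraMap A B) G₁ := by
      rw [hGt, map_homogeneousComponent, homogeneousComponent_eq_self hGhom]
    -- `Ĝ = G̃(X_1..X_e)` as a form in `X_0, X`
    set Gh : MvPolynomial (Fin (e + 1)) A := rename Fin.succ Gt with hGh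
    have hGhhom : Gh.IsHomogeneous d := hGthom.rename_isHomogeneous
    have hGheval : eval (Fin.cons t y : Fin (e + 1) → A) Gh = eval y Gt := by
      rw [hGh, eval_rename]; rfl
    -- `f(G̃(y)) = G(ȳ) ∈ 𝔪_B^{d+1}`, so `G̃(y) ∈ 𝔪_A^{d+1} + tA`
    have hfG : algebraMap A B (eval y Gt) ∈ maximalIdeal B ^ (d + 1) := by
      rw [map_eval, hGtmap]
      have : (algebraMap A B) ∘ y = ybar := funext hy
      rwa [this]
    rw [← map_pow_maximalIdeal_eq_of_surjective hf, ← Ideal.mem_comap, Ideal.comap_map_of_surjective _ hf,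
      ← RingHom.ker_eq_comap_bot, hK, Submodule.mem_sup] at hfG
    obtain ⟨m, hm, s, hs, hms⟩ := hfG
    obtain ⟨c, rfl⟩ := Ideal.mem_span_singleton'.mp hs
    -- `G̃(y) ∈ 𝔪^d`, hence `t c ∈ 𝔪^d`
    have hGd : eval y Gt ∈ maximalIdeal A ^ d := by
      rw [← hGheval]; exact Literature.RingTheory.HilbertSamuel.eval_mem_pow_of_isHomogeneous _ hz hGhhom
    cases d with
    | zero =>
      -- degree `0`: `G̃` is a constant in `𝔪`, so `ḡ = 0`
      have hc : Gt = C (coeff 0 G₁) := by rw [hGt, homogeneousComponent_zero]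
      have hG0 : MvPolynomial.map (residue B) (MvPolynomial.map (algebraMap A B) G₁) = 0 := by
        have hcoef : algebraMap A B (coeff 0 G₁) ∈ maximalIdeal B := by
          have h1 := hGy
          rw [← hGtmap, hc, map_C, eval_C, zero_add, pow_one] at h1
          exact h1
        rw [← hGtmap, hc, map_C, map_C, (residue_eq_zero_iff _).mpr hcoef, C_0]
      rw [hG0]; exact Ideal.zero_mem _
    | succ d =>
      have htc : t * c ∈ maximalIdeal A ^ (d + 1) := by
        have h' : c * t = eval y Gt - m := by rw [← hms]; ring
        rw [mul_comm, h']
        exact Ideal.sub_mem _ hGd (Ideal.pow_le_pow_right (Nat.le_succ _) hm)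
      have hc : c ∈ maximalIdeal A ^ d := mem_pow_of_mul_mem_pow_succ_of_hilbertSamuelFun_one_eq hf hK hH d htc
      rw [← hz] at hc
      obtain ⟨Hc, hHchom, hHc⟩ := (Ideal.mem_span_pow_iff_exists_isHomogeneous _ c).mp hc
      -- the form `F = Ĝ − X_0 · H_c` over `A`
      set F : MvPolynomial (Fin (e + 1)) A := Gh - Hc * X 0 with hF
      have hFhom : F.IsHomogeneous (d + 1) := hGhhom.sub (hHchom.mul (isHomogeneous_X A (0 : Fin (e + 1))))
      have hFeval : eval (Fin.cons t y : Fin (e + 1) → A) F ∈ maximalIdeal A ^ (d + 1 + 1) := by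
        rw [hF, map_sub, map_mul, eval_X, Fin.cons_zero, hGheval, hHc]
        have h' : eval y Gt - c * t = m := by rw [← hms]; ring
        rw [h']; exact hm
      have hFmem : MvPolynomial.map (residue A) F ∈ tangentConeIdeal (Fin.cons t y : Fin (e + 1) → A) hz :=
        mem_tangentConeIdeal_of_mem_symbolForms _ hz (d + 1)
          ((mem_symbolForms_iff_exists_form _ hz).mpr ⟨F, hFhom, hFeval, rfl⟩)
      have hθF' : θ (MvPolynomial.map (residue A) F) = MvPolynomial.map (residue B) (MvPolynomial.map (algebraMap A B) G₁) := by
        rw [hθF, hF, map_sub, map_sub, map_mul, map_mul, map_X, aeval_X, Fin.cons_zero, mul_zero, sub_zero, hGh,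
          killFirst_map_rename_succ, hGtmap]
      rw [← hθF']
      exact Ideal.mem_map_of_mem _ hFmem
  · -- `θ(J_z) ⊆ J_ȳ`
    rw [Ideal.map_le_iff_le_comap, tangentConeIdeal, Ideal.span_le]
    intro g hg
    obtain ⟨d, hgd⟩ := Set.mem_iUnion.mp hg
    obtain ⟨F, hFhom, hFz, rfl⟩ := (mem_symbolForms_iff_exists_form _ hz).mp hgd
    rw [SetLike.mem_coe, Ideal.mem_comap, hθF]
    refine mem_tangentConeIdeal_of_mem_symbolForms _ hybar d ((mem_symbolForms_iff_exists_form ybar hybar).mpr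
      ⟨_, isHomogeneous_killFirst (hFhom.map (algebraMap A B)), ?_, rfl⟩)
    rw [heval, ← map_pow_maximalIdeal_eq_of_surjective hf]
    exact Ideal.mem_map_of_mem _ hFz

end TangentCone

end CampaignW42

end Summit.ResolutionOfSingularities.ResolutionOfSingularities.Theorems

end
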